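import Summits.Parity.GeneralizedHardyLittlewood.Theorems.LeeYangFibresRelativeDimOneMoebiusSplitStubDefs
import Literature.NumberTheory.Sieve.LinearEquationsInPrimesProofs
import Mathlib
import HarnessLib

/-!
# Route `LeeYangFibres`, crux `RelativeDimOne` (stmt-Parity-14113), line `single-moebius-split`,
# stub `stub_tssCompose` (T1b-C) — auxiliary file 1: identification of the Goldston–Yıldırım sum
# and of the local factors of the root data of a `d = 1` system

For a system `Ψ = (ψ_i)_{i<t}` of affine-linear forms in one variable, the general-data
Goldston–Yıldırım sum of `TSSInduction` taken with FULL windows `W_p = {0, …, p − 1}` and the ROOT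
SETS `Z_{p,i} = rootSet Ψ p i = {r mod p : p ∣ ψ_i(r)}` is the truncated singular series, and its
expected local factors are Green–Tao's `β_p`:

* `tssC_gySum_eq` — `GY_t(R, g^Ψ; y) = 𝔖_R(Ψ)` for `y` above all levels: tuple by tuple, `μ`
  kills the non-square-free tuples on both sides, and `TSSLocalData t` (the Chinese remainder
  theorem, a HYPOTHESIS here) identifies `ρ_Ψ(d)/∏ d_i` with `∏_{p<y} g^Ψ_p({i : p ∣ d_i})`;
* `tssC_card_filter_notMem_rootSet`, `tssC_gyLocalFactor_eq` — at a prime `p`,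
  `β_p(W, Z^Ψ) = (p/(p−1))^t · #{r mod p : p ∤ ψ_i(r) ∀ i}/p = localFactor Ψ p`
  (tree `localFactor_prime`, `goodCount`; the bijection `r ↦ r mod p`, `{0,…,p−1} → ℤ/p`);
* `tssC_prod_gyLocalFactor_eq` — `∏_{p ≤ x} β_p = singularProductPartial Ψ x`;
* `tssC_identify` — the registered sub-goal: the difference estimated by `TSSInduction` is
  `𝔖_R(Ψ) − ∏_{p ≤ x} β_p`.

References: D. A. Goldston, C. Y. Yıldırım, Integers 3 (2003) A5 = arXiv:math/0111212, §2
[GoldstonYildirim2001]; B. Green, T. Tao, Ann. of Math. 171 (2010), (1.6) and App. D [GreenTao2010].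
-/

noncomputable section

open scoped BigOperators Classical
open Finset Literature.NumberTheory.Sieve

namespace Summit.Parity.GeneralizedHardyLittlewood.Cruxes.RelativeDimOne.SingleMoebiusSplit

variable {t : ℕ}

/-! ### Root sets read modulo `p` -/

/-- Membership in a root set, read modulo `p`: `r ∈ Z_{p,i}` iff `r < p` and `ψ_i(r) ≡ 0 (mod p)`
(`ψ(n) mod p = ψ_p(n mod p)`). -/
theorem tssC_mem_rootSet_iff (Ψ : Fin t → AffLinForm 1) (p : ℕ) (i : Fin t) (r : ℕ) :
    r ∈ rootSet Ψ p i ↔ r < p ∧ (Ψ i).modEval p (fun _ => (r : ZMod p)) = 0 := by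
  have h := AffLinForm.intCast_eval (Ψ i) p (fun _ => (r : ℤ))
  simp only [Int.cast_natCast] at h
  rw [rootSet, Finset.mem_filter, Finset.mem_range, ← h, ZMod.intCast_zmod_eq_zero_iff_dvd]

/-- The residues killed by no form are counted by Green–Tao's `goodCount`:
`#{r < p : r ∉ Z_{p,i} ∀ i} = #{v ∈ ℤ/p : ψ_i(v) ≢ 0 ∀ i}` (`r ↦ r mod p` is a bijection
`{0, …, p−1} → (Fin 1 → ZMod p)` with inverse `v ↦ val (v 0)`). -/
theorem tssC_card_filter_notMem_rootSet (Ψ : Fin t → AffLinForm 1) (p : ℕ) [NeZero p] :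
    ((Finset.range p).filter fun r => ∀ i, r ∉ rootSet Ψ p i).card = goodCount Ψ p := by
  unfold goodCount
  refine Finset.card_nbij' (fun n _ => (n : ZMod p)) (fun v => (v 0).val) (fun n hn => ?_)
    (fun v hv => ?_) (fun n hn => ?_) (fun v _ => ?_)
  · rw [Finset.mem_coe, Finset.mem_filter] at hn
    rw [Finset.mem_coe, Finset.mem_filter]
    exact ⟨Finset.mem_univ _, fun i h0 =>
      hn.2 i ((tssC_mem_rootSet_iff Ψ p i n).mpr ⟨Finset.mem_range.mp hn.1, h0⟩)⟩
  · rw [Finset.mem_coe, Finset.mem_filter] at hv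
    rw [Finset.mem_coe, Finset.mem_filter, Finset.mem_range]
    refine ⟨ZMod.val_lt (v 0), fun i hmem => hv.2 i ?_⟩
    have h := ((tssC_mem_rootSet_iff Ψ p i _).mp hmem).2
    have hfun : (fun _ : Fin 1 => (((v 0).val : ℕ) : ZMod p)) = v := by
      funext j
      rw [Fin.fin_one_eq_zero j, ZMod.natCast_zmod_val]
    rwa [hfun] at h
  · rw [Finset.mem_coe, Finset.mem_filter, Finset.mem_range] at hn
    exact ZMod.val_natCast_of_lt hn.1
  · funext j
    dsimp only
    rw [Fin.fin_one_eq_zero j, ZMod.natCast_zmod_val]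

/-! ### The local factors of the root data -/

/-- **The expected local factors of the root data are Green–Tao's local factors**: for a prime `p`,
`β_p(range, Z^Ψ) = (p/(p−1))^t · #{r mod p : p ∤ ψ_i(r) ∀ i}/p = localFactor Ψ p`
(tree `localFactor_prime`). -/
theorem tssC_gyLocalFactor_eq (Ψ : Fin t → AffLinForm 1) {p : ℕ} (hp : p.Prime) :
    gyLocalFactor (fun q => Finset.range q) (rootSet Ψ) p = localFactor Ψ p := by
  haveI := Fact.mk hp
  simp only [gyLocalFactor]
  rw [tssC_card_filter_notMem_rootSet, localFactor_prime, pow_one]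
  ring

/-- `∏_{p < x+1} β_p(range, Z^Ψ) = ∏_{p ≤ x} localFactor Ψ p = singularProductPartial Ψ x`
(`Nat.primesBelow (x + 1) = Nat.primesLE x`). -/
theorem tssC_prod_gyLocalFactor_eq (Ψ : Fin t → AffLinForm 1) (x : ℕ) :
    ∏ p ∈ Nat.primesBelow (x + 1), gyLocalFactor (fun q => Finset.range q) (rootSet Ψ) p =
      singularProductPartial Ψ x := by
  unfold singularProductPartial
  show _ = ∏ p ∈ Nat.primesBelow (x + 1), localFactor Ψ p
  exact Finset.prod_congr rfl fun p hp => tssC_gyLocalFactor_eq Ψ (Nat.prime_of_mem_primesBelow hp)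

/-! ### The Goldston–Yıldırım sum of the root data -/

/-- **The Goldston–Yıldırım sum of the root data is the truncated singular series**: for `y` above
all levels, `GY_t(R, g^Ψ; y) = 𝔖_R(Ψ)`. Tuple by tuple: if some `d_i` is not square-free then
`μ(d_i) = 0` kills both summands; otherwise `TSSLocalData` rewrites `ρ_Ψ(d)/∏ d_i` as
`∏_{p<y} g^Ψ_p({i : p ∣ d_i})` (`1 ≤ d_i ≤ ⌊R_i⌋ < y`). -/
theorem tssC_gySum_eq (hB : TSSLocalData t) (Ψ : Fin t → AffLinForm 1) (R : Fin t → ℝ) {y : ℕ}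
    (hy : ∀ i, ⌊R i⌋₊ < y) :
    gySum R (gyWeight (fun p => Finset.range p) (rootSet Ψ)) y = truncSingularSeries Ψ R := by
  unfold gySum truncSingularSeries
  refine Finset.sum_congr rfl fun d hd => ?_
  rw [Fintype.mem_piFinset] at hd
  have hpos : ∀ i, 0 < d i := fun i => (Finset.mem_Icc.mp (hd i)).1
  have hlt : ∀ i, d i < y := fun i => ((Finset.mem_Icc.mp (hd i)).2).trans_lt (hy i)
  by_cases hsq : ∀ i, Squarefree (d i)
  · rw [mul_div_assoc, hB Ψ d y hpos hsq hlt]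
  · obtain ⟨i, hi⟩ := not_forall.mp hsq
    have h0 : (∏ i, ((ArithmeticFunction.moebius (d i) : ℤ) : ℝ) * Real.log (R i / d i)) = 0 :=
      Finset.prod_eq_zero (Finset.mem_univ i) (by
        rw [ArithmeticFunction.moebius_eq_zero_of_not_squarefree hi, Int.cast_zero, zero_mul])
    rw [h0, zero_mul, zero_mul, zero_div]

/-! ### The registered sub-goal: the identification -/

/-- **T1b-C, identification step** (registered sub-goal `tssC_identify` for `stub_tssCompose`).
Given the local data `TSSLocalData t` (Chinese remainder theorem), for every system `Ψ` of `t`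
affine-linear forms in one variable, levels `R` and cut-off `x + 1` above all `⌊R_i⌋`, the
difference `GY_t(R, g_{W,Z}; x+1) − ∏_{p < x+1} β_p(W, Z)` of `TSSInduction`, taken with full
windows `W_p = {0, …, p−1}` and the root sets `Z = rootSet Ψ`, is LITERALLY
`𝔖_R(Ψ) − ∏_{p ≤ x} β_p(Ψ) = truncSingularSeries Ψ R − singularProductPartial Ψ x`. -/
theorem tssC_identify : ∀ (t : ℕ), TSSLocalData t → ∀ (Ψ : Fin t → AffLinForm 1) (R : Fin t → ℝ)
    (x : ℕ), (∀ i, ⌊R i⌋₊ < x + 1) →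
    gySum R (gyWeight (fun p => Finset.range p) (rootSet Ψ)) (x + 1) -
        ∏ p ∈ Nat.primesBelow (x + 1), gyLocalFactor (fun p => Finset.range p) (rootSet Ψ) p =
      truncSingularSeries Ψ R - singularProductPartial Ψ x := by
  intro t hB Ψ R x hx
  rw [tssC_gySum_eq hB Ψ R hx, tssC_prod_gyLocalFactor_eq]

end Summit.Parity.GeneralizedHardyLittlewood.Cruxes.RelativeDimOne.SingleMoebiusSplit
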